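import Summits.Ventures.PercRepro.S2DichotomyTools
import Summits.Ventures.PercRepro.S2TailCell
import Summits.Ventures.PercRepro.S2SpanningCount
import Summits.Ventures.PercRepro.S2FlatCountTwo
import Summits.Ventures.PercRepro.S2PhiFourteenFive
import Summits.Ventures.PercRepro.S2CapFree
import Summits.Ventures.PercRepro.TriangleCapEightI
import Summits.Ventures.PercRepro.S1CoreCapSevenFinal
import Summits.Ventures.PercRepro.S1FiveCircuitBase
import Summits.Ventures.PercRepro.S2TopGraded
import Summits.Ventures.PercRepro.S2MaxExtension
import Summits.Ventures.PercRepro.S2FlatCountTwoSharp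

/-!
# PercRepro — S2: THE CELL `(14, 10)` OF THE `q = 5` WINDOW BY THE SHARPENED FLAT COUNT AND THE GRADED PARTITION COUNT (p7, gen 13; sub-claim S2; the `p = 14` row)

The nested dichotomy on «a set `W` of nullity `k` on `≤ 5 + k` points», `k = 9, …, 4`, with the concentrated tail (`S2.ncard_spanning_le_of_nullity`):
`ν = 9` size by size, `ν = 8` by the flat count SHARPENED at `m = 5` (`topCount_le_flat_count_two_sharp`, S2FlatCountTwoSharp: `360,932 < 370,569`), `ν = 7` by
THE GRADED PARTITION COUNT (`topCount_le_payment_graded_of_ext`, S2TopGraded: the spanning `6`-sets with a maximal closure of `12` points are few — at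
most `e = 8` maximal extensions of every rank-`4` flat with `≥ 5` points, `S2.card_maxExt_le`; `357,253 < 357,764`), `ν = 6, …, 4` by the payment count;
spread with the kit's tail (`gencellg.py`; every numeral exact; the exact `Φ(14, 5) = 380/9 ≤ 2^19/12417`; standard caps `20 / 174 / 1518`, no coloop split).
**`ThmN.c025_core_five_fourteen_ten (M) [M.Finite] (hR : ρ(E) = 14) (hn : |E| = 24) (hfree) : RLS M 14 5`**. Axioms: standard.
-/

open scoped Matroid

namespace PercRepro

namespace ThmN

open Set

variable {α : Type}

/-- The standard caps at `(14, 10)`: `s₃ ≤ 20` (`TriangleCap.cq3 10`), `s₄ ≤ 174` (`S1.avgBoundSeven 3`, the `Q*(7) = 19` chain), `s₅ ≤ 1518` (`S1.avgChain5b 10`) on every `e`-free core of nullity `10`. -/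
theorem caps_fourteen_ten (M : Matroid α) [M.Finite]
    (hd : M.E.encard = M.eRank + ((10 : ℕ) : ℕ∞))
    (hfree : ∀ e ∈ M.E, ∃ A ⊆ M.E \ {e}, e ∉ M.closure A ∧ e ∉ M.closure ((M.E \ {e}) \ A)) :
    {C : Set α | M.IsCircuit C ∧ C.ncard = 3}.ncard ≤ 20 ∧
      {C : Set α | M.IsCircuit C ∧ C.ncard = 4}.ncard ≤ 174 ∧
        {C : Set α | M.IsCircuit C ∧ C.ncard = 5}.ncard ≤ 1518 := by
  have hs3 := TriangleCap.core_ncard_triangles_le_cq3 M hfree hd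
  rw [show TriangleCap.cq3 10 = 20 by decide] at hs3
  have hs4 := S1.ncard_fourCircuits_le_avgBoundSeven 3 M hfree (by convert hd using 2; norm_num)
  rw [show S1.avgBoundSeven 3 = 174 by decide] at hs4
  have hs5 := S1.ncard_fiveCircuits_le_avgChain5b 10 M hfree hd
  rw [show S1.avgChain5b 10 = 1518 by decide] at hs5
  exact ⟨hs3, hs4, hs5⟩

/-- The tail side of the cell `(14, 10)` on the caps `20 / 174 / 1518` with the spanning count `S` a parameter: the rank-`≤ 5` part
of the kit's tail is exactly `317533123688771 / 503962200 = 630,073.3`, so `1024·(T + S) ≤ m·2^24` whenever `1024·(317533123688771 / 503962200 + S) ≤ m·2^24`. -/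
theorem tail_fourteen_ten (S m : ℕ) (h : (1024 : ℚ) * ((317533123688771 / 503962200 : ℚ) + (S : ℚ)) ≤ (m : ℚ) * 2 ^ 24) :
    1024 * ((((14 + 10).choose 4 : ℚ) +
      (∑ j ∈ Finset.range 6, (Nat.choose (min 5 ((10 + 3) / 2 + 1 - 2)) j : ℚ) / (((j + 1) + 3 * (j + 1).choose 2 + 3 * (j + 1).choose 3 + 2 * (j + 1).choose 4 : ℕ) : ℚ)) *
        ((20 * (14 + 10 - 3).choose 2 + 174 * (14 + 10 - 4) + 1518 : ℕ) : ℚ) +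
      ((∑ j ∈ Finset.range 6, (Nat.choose 5 j : ℚ) / (((j + 1) + 3 * (j + 1).choose 2 + 3 * (j + 1).choose 3 + 2 * (j + 1).choose 4 : ℕ) : ℚ)) -
        (∑ j ∈ Finset.range 6, (Nat.choose (min 5 ((10 + 3) / 2 + 1 - 2)) j : ℚ) / (((j + 1) + 3 * (j + 1).choose 2 + 3 * (j + 1).choose 3 + 2 * (j + 1).choose 4 : ℕ) : ℚ))) *
        ((10 : ℕ).choose 5 : ℚ)) +
      (((14 + 10).choose 3 * 2 ^ 3 + (14 + 10).choose 2 * 2 + (14 + 10) + 1 : ℕ) : ℚ) +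
      (((14 + 10).choose 5 : ℚ) + (∑ j ∈ Finset.range (10), (Nat.choose (min 13 ((10 + 6) / 2 + 1 - 2)) j : ℚ) / (((j + 1) + 3 * (j + 1).choose 2 + 3 * (j + 1).choose 3 + 2 * (j + 1).choose 4 : ℕ) : ℚ)) * ((20 * (14 + 10 - 3).choose 3 + 174 * (14 + 10 - 4).choose 2 + 1518 * (14 + 10 - 5) + (10 + 5).choose 6 : ℕ) : ℚ) +
        ((∑ j ∈ Finset.range (10), (Nat.choose (min 19 (5 + 10) - 6) j : ℚ) / (((j + 1) + 3 * (j + 1).choose 2 + 3 * (j + 1).choose 3 + 2 * (j + 1).choose 4 : ℕ) : ℚ)) - (∑ j ∈ Finset.range (10), (Nat.choose (min 13 ((10 + 6) / 2 + 1 - 2)) j : ℚ) / (((j + 1) + 3 * (j + 1).choose 2 + 3 * (j + 1).choose 3 + 2 * (j + 1).choose 4 : ℕ) : ℚ))) *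
        ((min 19 (5 + 10)).choose 6 : ℚ)) +
      (S : ℚ)) ≤ (m : ℚ) * 2 ^ (14 + 10) := by
  have hsm : (∑ j ∈ Finset.range (10), (Nat.choose (min 13 ((10 + 6) / 2 + 1 - 2)) j : ℚ) / (((j + 1) + 3 * (j + 1).choose 2 + 3 * (j + 1).choose 3 + 2 * (j + 1).choose 4 : ℕ) : ℚ)) = 6418141 / 1184400 := by
    norm_num [Finset.sum_range_succ, Nat.choose]
  have hsg : (∑ j ∈ Finset.range (10), (Nat.choose (min 19 (5 + 10) - 6) j : ℚ) / (((j + 1) + 3 * (j + 1).choose 2 + 3 * (j + 1).choose 3 + 2 * (j + 1).choose 4 : ℕ) : ℚ)) = 295528511 / 27997900 := by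
    norm_num [Finset.sum_range_succ, Nat.choose]
  have hs4m : (∑ j ∈ Finset.range 6, (Nat.choose (min 5 ((10 + 3) / 2 + 1 - 2)) j : ℚ) / (((j + 1) + 3 * (j + 1).choose 2 + 3 * (j + 1).choose 3 + 2 * (j + 1).choose 4 : ℕ) : ℚ)) = 12767 / 4230 := by
    norm_num [Finset.sum_range_succ, Nat.choose]
  have hs4g : (∑ j ∈ Finset.range 6, (Nat.choose 5 j : ℚ) / (((j + 1) + 3 * (j + 1).choose 2 + 3 * (j + 1).choose 3 + 2 * (j + 1).choose 4 : ℕ) : ℚ)) = 12767 / 4230 := by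
    norm_num [Finset.sum_range_succ, Nat.choose]
  rw [hsm, hsg, hs4m, hs4g]
  norm_num [Nat.choose] at h ⊢
  linarith

/-- the graded weights of the case `ν = 7`: `σ_lo = 271 / 90` (closures of `≤ 11` points). -/
theorem sig_fourteen_ten_7_lo : (∑ j ∈ Finset.range (10 - 5), (Nat.choose (12 - 1 - 6) j : ℚ) / (((j + 1) + 3 * (j + 1).choose 2 + 3 * (j + 1).choose 3 + 2 * (j + 1).choose 4 : ℕ) : ℚ)) = 271 / 90 := by
  norm_num [Finset.sum_range_succ, Nat.choose]

/-- the graded weights of the case `ν = 7`: `σ_hi = 178 / 45` (the maximal closures of `12` points). -/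
theorem sig_fourteen_ten_7_hi : (∑ j ∈ Finset.range (10 - 5), (Nat.choose (12 - 6) j : ℚ) / (((j + 1) + 3 * (j + 1).choose 2 + 3 * (j + 1).choose 3 + 2 * (j + 1).choose 4 : ℕ) : ℚ)) = 178 / 45 := by
  norm_num [Finset.sum_range_succ, Nat.choose]

/-- the weights of the case `ν = 6`: `σ_m = 271 / 90`, `σ_g = 271 / 90`. -/
theorem sig_fourteen_ten_6_m : (∑ j ∈ Finset.range (10 - 5), (Nat.choose (min (11 - 6) ((10 + 6) / 2 + 1 - 2)) j : ℚ) / (((j + 1) + 3 * (j + 1).choose 2 + 3 * (j + 1).choose 3 + 2 * (j + 1).choose 4 : ℕ) : ℚ)) = 271 / 90 := by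
  norm_num [Finset.sum_range_succ, Nat.choose]

/-- the weights of the case `ν = 6`, the giant term. -/
theorem sig_fourteen_ten_6_g : (∑ j ∈ Finset.range (10 - 5), (Nat.choose (min 11 (5 + 10) - 6) j : ℚ) / (((j + 1) + 3 * (j + 1).choose 2 + 3 * (j + 1).choose 3 + 2 * (j + 1).choose 4 : ℕ) : ℚ)) = 271 / 90 := by
  norm_num [Finset.sum_range_succ, Nat.choose]

/-- the weights of the case `ν = 5`: `σ_m = 523 / 225`, `σ_g = 523 / 225`. -/
theorem sig_fourteen_ten_5_m : (∑ j ∈ Finset.range (10 - 5), (Nat.choose (min (10 - 6) ((10 + 6) / 2 + 1 - 2)) j : ℚ) / (((j + 1) + 3 * (j + 1).choose 2 + 3 * (j + 1).choose 3 + 2 * (j + 1).choose 4 : ℕ) : ℚ)) = 523 / 225 := by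
  norm_num [Finset.sum_range_succ, Nat.choose]

/-- the weights of the case `ν = 5`, the giant term. -/
theorem sig_fourteen_ten_5_g : (∑ j ∈ Finset.range (10 - 5), (Nat.choose (min 10 (5 + 10) - 6) j : ℚ) / (((j + 1) + 3 * (j + 1).choose 2 + 3 * (j + 1).choose 3 + 2 * (j + 1).choose 4 : ℕ) : ℚ)) = 523 / 225 := by
  norm_num [Finset.sum_range_succ, Nat.choose]

/-- the weights of the case `ν = 4`: `σ_m = 329 / 180`, `σ_g = 329 / 180`. -/
theorem sig_fourteen_ten_4_m : (∑ j ∈ Finset.range (10 - 5), (Nat.choose (min (9 - 6) ((10 + 6) / 2 + 1 - 2)) j : ℚ) / (((j + 1) + 3 * (j + 1).choose 2 + 3 * (j + 1).choose 3 + 2 * (j + 1).choose 4 : ℕ) : ℚ)) = 329 / 180 := by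
  norm_num [Finset.sum_range_succ, Nat.choose]

/-- the weights of the case `ν = 4`, the giant term. -/
theorem sig_fourteen_ten_4_g : (∑ j ∈ Finset.range (10 - 5), (Nat.choose (min 9 (5 + 10) - 6) j : ℚ) / (((j + 1) + 3 * (j + 1).choose 2 + 3 * (j + 1).choose 3 + 2 * (j + 1).choose 4 : ℕ) : ℚ)) = 329 / 180 := by
  norm_num [Finset.sum_range_succ, Nat.choose]

/-- the weights of the spread case: `σ_m = 22 / 15`, `σ_g = 22 / 15`. -/
theorem sig_fourteen_ten_sp_m : (∑ j ∈ Finset.range (10 - 5), (Nat.choose (min (8 - 6) ((10 + 6) / 2 + 1 - 2)) j : ℚ) / (((j + 1) + 3 * (j + 1).choose 2 + 3 * (j + 1).choose 3 + 2 * (j + 1).choose 4 : ℕ) : ℚ)) = 22 / 15 := by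
  norm_num [Finset.sum_range_succ, Nat.choose]

/-- the weights of the spread case, the giant term. -/
theorem sig_fourteen_ten_sp_g : (∑ j ∈ Finset.range (10 - 5), (Nat.choose (min 8 (5 + 10) - 6) j : ℚ) / (((j + 1) + 3 * (j + 1).choose 2 + 3 * (j + 1).choose 3 + 2 * (j + 1).choose 4 : ℕ) : ℚ)) = 22 / 15 := by
  norm_num [Finset.sum_range_succ, Nat.choose]

/-- **The cell `(14, 10)` by the nested dichotomy with the concentrated tail**: `RLS M 14 5` on every `e`-free core of rank `14` on `24`
points (standard caps `20 / 174 / 1518`, `phiK 14 5 ≤ 2^19/12417`; the cases `ν = 9, …, 4` on `≤ 14, …, 9` points each with its own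
spanning count and slack (`full` / `pay` / `flat` / `graded` = the graded partition count), then spread with the kit's tail, slack `316/1024`). -/
theorem c025_core_five_fourteen_ten (M : Matroid α) [M.Finite]
    (hR : M.eRank = ((14 : ℕ) : ℕ∞)) (hn : M.E.ncard = 14 + 10)
    (hfree : ∀ e ∈ M.E, ∃ A ⊆ M.E \ {e}, e ∉ M.closure A ∧ e ∉ M.closure ((M.E \ {e}) \ A)) :
    RLS M 14 5 := by
  classical
  have hd : M.E.encard = M.eRank + ((10 : ℕ) : ℕ∞) := by
    rw [hR, ← M.ground_finite.cast_ncard_eq, hn]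
    push_cast
    ring
  obtain ⟨hs3, hs4, hs5⟩ := caps_fourteen_ten M hd hfree
  have full : ∀ (k : ℕ) {W : Set α}, W ⊆ M.E → W.encard = M.eRk W + k →
      Matroid.topCount M 14 5 ≤ ∑ m ∈ Finset.Icc 5 10, ∑ j ∈ Finset.Icc (m + k - 10) m,
        W.ncard.choose j * (14 + 10 - W.ncard).choose (m - j) := by
    intro k W hW hWk
    refine (S2.topCount_le_sum_spanning M hR hd 5).trans ?_
    refine Finset.sum_le_sum (fun m _ => ?_)
    have h := S2.ncard_spanning_compl_le_of_nullity M hW hd hWk (m := m)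
    rw [hn] at h
    exact h
  have span : ∀ (k : ℕ) {W : Set α}, W ⊆ M.E → W.encard = M.eRk W + k →
      {X : Set α | X ⊆ M.E ∧ M.eRk X = M.eRank}.ncard ≤ ∑ m ∈ Finset.range (10 + 1), ∑ j ∈ Finset.Icc (m + k - 10) m,
        W.ncard.choose j * (14 + 10 - W.ncard).choose (m - j) := by
    intro k W hW hWk
    have h := S2.ncard_spanning_le_of_nullity M hW hd hWk
    rw [hn] at h
    exact h
  have cell : ∀ (U S m : ℕ), Matroid.topCount M 14 5 ≤ U → {X : Set α | X ⊆ M.E ∧ M.eRk X = M.eRank}.ncard ≤ S → m ≤ 1024 →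
      1024 * (U : ℚ) ≤ ((1024 - m : ℕ) : ℚ) * 2 ^ (10 - 5) * (12417 : ℚ) →
      (1024 : ℚ) * ((317533123688771 / 503962200 : ℚ) + (S : ℚ)) ≤ (m : ℚ) * 2 ^ 24 → RLS M 14 5 := by
    intro U S m hU hS hm hpoly htail
    rw [RLS_iff]
    exact c025_core_five_cell_of_topCount_spanning_xqictq5g M 14 10 (by norm_num) hR hn hfree 20 174 1518 hs3 hs4 hs5 U hU S hS
      12417 (by norm_num) (phiK 14 5) (by rw [S2.phiK_fourteen_five]; norm_num) ⟨m, hm, hpoly, tail_fourteen_ten S m htail⟩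
  by_cases h9 : ∃ W ⊆ M.E, W.ncard ≤ 14 ∧ W.encard = M.eRk W + 9
  · obtain ⟨W, hW, hWn, hWk⟩ := h9
    have hU' : Matroid.topCount M 14 5 ≤ 158873 := by
      refine (full 9 hW hWk).trans ?_
      generalize W.ncard = w at hWn ⊢
      interval_cases w <;> decide
    have hS' : {X : Set α | X ⊆ M.E ∧ M.eRk X = M.eRank}.ncard ≤ 165044 := by
      refine (span 9 hW hWk).trans ?_
      generalize W.ncard = w at hWn ⊢
      interval_cases w <;> decide
    exact cell 158873 165044 49 hU' hS' (by norm_num) (by norm_num) (by norm_num)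
  by_cases h8 : ∃ W ⊆ M.E, W.ncard ≤ 13 ∧ W.encard = M.eRk W + 8
  · obtain ⟨W, hW, hWn, hWk⟩ := h8
    have hU := topCount_le_flat_count_two_sharp M 14 10 (by norm_num) hR hn hfree hW (by norm_num; exact hWk) hWn (by
      rintro ⟨W', hW'E, hW'n, hW'k⟩
      exact h9 ⟨W', hW'E, by omega, by norm_num at hW'k; exact hW'k⟩)
    have hU' : Matroid.topCount M 14 5 ≤ 370569 := by
      generalize W.ncard = w at hWn hU
      rw [Finset.sum_Icc_succ_top (by norm_num : 5 ≤ 10), Finset.sum_Icc_succ_top (by norm_num : 5 ≤ 9), Finset.sum_Icc_succ_top (by norm_num : 5 ≤ 8), Finset.sum_Icc_succ_top (by norm_num : 5 ≤ 7), Finset.sum_Icc_succ_top (by norm_num : 5 ≤ 6), Finset.Icc_self, Finset.sum_singleton] at hU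
      interval_cases w <;> norm_num [Nat.choose] at hU <;>
        first
          | omega
          | (have hUq : (Matroid.topCount M 14 5 : ℚ) ≤ 370569 := by linarith
             exact_mod_cast hUq)
    have hS' : {X : Set α | X ⊆ M.E ∧ M.eRk X = M.eRank}.ncard ≤ 484499 := by
      refine (span 8 hW hWk).trans ?_
      generalize W.ncard = w at hWn ⊢
      interval_cases w <;> decide
    exact cell 370569 484499 69 hU' hS' (by norm_num) (by norm_num) (by norm_num)
  by_cases h7 : ∃ W ⊆ M.E, W.ncard ≤ 12 ∧ W.encard = M.eRk W + 7
  · obtain ⟨W, hW, hWn, hWk⟩ := h7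
    have hflat : ∀ X ⊆ M.E, M.eRk X ≤ 5 → X.ncard ≤ 12 := fun X hX hr => by
      have := S2.ncard_le_of_eRk_le_of_not_nullity M 8 13 (by norm_num) h8 hX (r := 5) (by norm_num) (by exact_mod_cast hr)
      omega
    have hflat' : ∀ X ⊆ M.E, M.eRk X ≤ 4 → X.ncard ≤ 10 := fun X hX hr =>
      ncard_le_ten_of_eRk_le_four_of_free M hfree hX hr
    have he : ∀ P ⊆ M.E, M.closure P = P → M.eRk P = 4 → 5 ≤ P.ncard →
        ({x ∈ M.E \ P | (M.closure (insert x P)).ncard = 12}).ncard ≤ 8 := by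
      intro P hP hPflat hPr hP5
      have hq : P.ncard ≤ 10 := hflat' P hP (le_of_eq hPr)
      have hPr' : M.eRk P = ((4 : ℕ) : ℕ∞) := by exact_mod_cast hPr
      by_cases hq2 : P.ncard + 2 ≤ 12
      · refine (S2.card_maxExt_le hR hn hP hPflat hPr' 12 hq2).trans ?_
        generalize P.ncard = q at hq hq2 hP5 ⊢
        interval_cases q <;> decide
      · refine (S2.card_maxExt_le_ncard_diff P 12).trans ?_
        rw [Set.ncard_sdiff hP (M.ground_finite.subset hP), hn]
        omega
    have hV := S2.ncard_spanning_compl_le_of_nullity M hW hd hWk (m := 5)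
    have hV' : ∑ j ∈ Finset.Icc (5 + 7 - 10) 5, W.ncard.choose j * (M.E.ncard - W.ncard).choose (5 - j) ≤ 35772 := by
      rw [hn]
      generalize W.ncard = w at hWn ⊢
      interval_cases w <;> decide
    have hU := topCount_le_payment_graded_of_ext M 14 10 (by norm_num) hR hn hfree 12 hflat
      20 174 1518 hs3 hs4 hs5 8 he 35772 (hV.trans hV')
    rw [sig_fourteen_ten_7_lo, sig_fourteen_ten_7_hi] at hU
    norm_num [Nat.choose] at hU
    have hUq : (Matroid.topCount M 14 5 : ℚ) ≤ 357764 := by linarith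
    have hU' : Matroid.topCount M 14 5 ≤ 357764 := by exact_mod_cast hUq
    have hS' : {X : Set α | X ⊆ M.E ∧ M.eRk X = M.eRank}.ncard ≤ 1029329 := by
      refine (span 7 hW hWk).trans ?_
      generalize W.ncard = w at hWn ⊢
      interval_cases w <;> decide
    exact cell 357764 1029329 102 hU' hS' (by norm_num) (by norm_num) (by norm_num)
  by_cases h6 : ∃ W ⊆ M.E, W.ncard ≤ 11 ∧ W.encard = M.eRk W + 6
  · obtain ⟨W, hW, hWn, hWk⟩ := h6
    have hflat : ∀ X ⊆ M.E, M.eRk X ≤ 5 → X.ncard ≤ 11 := fun X hX hr => by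
      have := S2.ncard_le_of_eRk_le_of_not_nullity M 7 12 (by norm_num) h7 hX (r := 5) (by norm_num) (by exact_mod_cast hr)
      omega
    have hflat' : ∀ X ⊆ M.E, M.eRk X ≤ 4 → X.ncard ≤ 10 := fun X hX hr =>
      ncard_le_ten_of_eRk_le_four_of_free M hfree hX hr
    have hV := S2.ncard_spanning_compl_le_of_nullity M hW hd hWk (m := 5)
    have hV' : ∑ j ∈ Finset.Icc (5 + 6 - 10) 5, W.ncard.choose j * (M.E.ncard - W.ncard).choose (5 - j) ≤ 41217 := by
      rw [hn]
      generalize W.ncard = w at hWn ⊢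
      interval_cases w <;> decide
    have hU := topCount_le_payment_flat M 14 10 (by norm_num) hR hn hfree 11 10 hflat hflat' (by norm_num) (by norm_num)
      20 174 1518 hs3 hs4 hs5 41217 (hV.trans hV')
    rw [sig_fourteen_ten_6_m, sig_fourteen_ten_6_g] at hU
    norm_num [Nat.choose] at hU
    have hUq : (Matroid.topCount M 14 5 : ℚ) ≤ 340303 := by linarith
    have hU' : Matroid.topCount M 14 5 ≤ 340303 := by exact_mod_cast hUq
    have hS' : {X : Set α | X ⊆ M.E ∧ M.eRk X = M.eRank}.ncard ≤ 1764899 := by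
      refine (span 6 hW hWk).trans ?_
      generalize W.ncard = w at hWn ⊢
      interval_cases w <;> decide
    exact cell 340303 1764899 147 hU' hS' (by norm_num) (by norm_num) (by norm_num)
  by_cases h5 : ∃ W ⊆ M.E, W.ncard ≤ 10 ∧ W.encard = M.eRk W + 5
  · obtain ⟨W, hW, hWn, hWk⟩ := h5
    have hflat : ∀ X ⊆ M.E, M.eRk X ≤ 5 → X.ncard ≤ 10 := fun X hX hr => by
      have := S2.ncard_le_of_eRk_le_of_not_nullity M 6 11 (by norm_num) h6 hX (r := 5) (by norm_num) (by exact_mod_cast hr)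
      omega
    have hflat' : ∀ X ⊆ M.E, M.eRk X ≤ 4 → X.ncard ≤ 9 := fun X hX hr => by
      have := S2.ncard_le_of_eRk_le_of_not_nullity M 6 11 (by norm_num) h6 hX (r := 4) (by norm_num) (by exact_mod_cast hr)
      omega
    have hV := S2.ncard_spanning_compl_le_of_nullity M hW hd hWk (m := 5)
    have hV' : ∑ j ∈ Finset.Icc (5 + 5 - 10) 5, W.ncard.choose j * (M.E.ncard - W.ncard).choose (5 - j) ≤ 42504 := by
      rw [hn]
      generalize W.ncard = w at hWn ⊢
      interval_cases w <;> decide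
    have hU := topCount_le_payment_flat M 14 10 (by norm_num) hR hn hfree 10 9 hflat hflat' (by norm_num) (by norm_num)
      20 174 1518 hs3 hs4 hs5 42504 (hV.trans hV')
    rw [sig_fourteen_ten_5_m, sig_fourteen_ten_5_g] at hU
    norm_num [Nat.choose] at hU
    have hUq : (Matroid.topCount M 14 5 : ℚ) ≤ 320901 := by linarith
    have hU' : Matroid.topCount M 14 5 ≤ 320901 := by exact_mod_cast hUq
    have hS' : {X : Set α | X ⊆ M.E ∧ M.eRk X = M.eRank}.ncard ≤ 2586005 := by
      refine (span 5 hW hWk).trans ?_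
      generalize W.ncard = w at hWn ⊢
      interval_cases w <;> decide
    exact cell 320901 2586005 197 hU' hS' (by norm_num) (by norm_num) (by norm_num)
  by_cases h4 : ∃ W ⊆ M.E, W.ncard ≤ 9 ∧ W.encard = M.eRk W + 4
  · obtain ⟨W, hW, hWn, hWk⟩ := h4
    have hflat : ∀ X ⊆ M.E, M.eRk X ≤ 5 → X.ncard ≤ 9 := fun X hX hr => by
      have := S2.ncard_le_of_eRk_le_of_not_nullity M 5 10 (by norm_num) h5 hX (r := 5) (by norm_num) (by exact_mod_cast hr)
      omega
    have hflat' : ∀ X ⊆ M.E, M.eRk X ≤ 4 → X.ncard ≤ 8 := fun X hX hr => by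
      have := S2.ncard_le_of_eRk_le_of_not_nullity M 5 10 (by norm_num) h5 hX (r := 4) (by norm_num) (by exact_mod_cast hr)
      omega
    have hV := S2.ncard_spanning_compl_le_of_nullity M hW hd hWk (m := 5)
    have hV' : ∑ j ∈ Finset.Icc (5 + 4 - 10) 5, W.ncard.choose j * (M.E.ncard - W.ncard).choose (5 - j) ≤ 42504 := by
      rw [hn]
      generalize W.ncard = w at hWn ⊢
      interval_cases w <;> decide
    have hU := topCount_le_payment_flat M 14 10 (by norm_num) hR hn hfree 9 8 hflat hflat' (by norm_num) (by norm_num)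
      20 174 1518 hs3 hs4 hs5 42504 (hV.trans hV')
    rw [sig_fourteen_ten_4_m, sig_fourteen_ten_4_g] at hU
    norm_num [Nat.choose] at hU
    have hUq : (Matroid.topCount M 14 5 : ℚ) ≤ 302664 := by linarith
    have hU' : Matroid.topCount M 14 5 ≤ 302664 := by exact_mod_cast hUq
    have hS' : {X : Set α | X ⊆ M.E ∧ M.eRk X = M.eRank}.ncard ≤ 3354773 := by
      refine (span 4 hW hWk).trans ?_
      generalize W.ncard = w at hWn ⊢
      interval_cases w <;> decide
    exact cell 302664 3354773 244 hU' hS' (by norm_num) (by norm_num) (by norm_num)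
  · -- spread: rank-`5` sets `≤ 8`, rank-`4` sets `≤ 7`; the kit's spanning bound `Σ_{j ≤ 10} C(24, j) = 4540386`
    have hflat : ∀ X ⊆ M.E, M.eRk X ≤ 5 → X.ncard ≤ 8 := fun X hX hr => by
      have := S2.ncard_le_of_eRk_le_of_not_nullity M 4 9 (by norm_num) h4 hX (r := 5) (by norm_num) (by exact_mod_cast hr)
      omega
    have hflat' : ∀ X ⊆ M.E, M.eRk X ≤ 4 → X.ncard ≤ 7 := fun X hX hr => by
      have := S2.ncard_le_of_eRk_le_of_not_nullity M 4 9 (by norm_num) h4 hX (r := 4) (by norm_num) (by exact_mod_cast hr)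
      omega
    have hU := topCount_le_flat M 14 10 (by norm_num) hR hn hfree 8 7 hflat hflat' (by norm_num) (by norm_num)
      20 174 1518 hs3 hs4 hs5
    rw [sig_fourteen_ten_sp_m, sig_fourteen_ten_sp_g] at hU
    norm_num [Nat.choose] at hU
    have hUq : (Matroid.topCount M 14 5 : ℚ) ≤ 274726 := by linarith
    have hU' : Matroid.topCount M 14 5 ≤ 274726 := by exact_mod_cast hUq
    have hEcard : M.ground_finite.toFinset.card = 14 + 10 := by
      rw [← Set.ncard_eq_toFinset_card _ M.ground_finite]; exact hn
    have hS := Matroid.ncard_spanning_le (M := M) hd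
    rw [hEcard] at hS
    have hS' : {X : Set α | X ⊆ M.E ∧ M.eRk X = M.eRank}.ncard ≤ 4540386 := hS.trans (by decide)
    exact cell 274726 4540386 316 hU' hS' (by norm_num) (by norm_num) (by norm_num)

end ThmN

end PercRepro
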